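import Summits.QuantumFields.BalabanUV.InfraRed.StrongCouplingSharpTwist
import HarnessLib

/-!
# Venture YMGap — the TWISTED pointwise Bochner inequality on `SU(N)` for EVERY `N`, with the dimensional term
# through a Gram identity of the Parseval frame

HONEST FRAMING.  Venture file of the cell `pub-ymgap` (QuantumFields programme), seat engine-2 (g11); 0 compute.  Pure frame
calculus on `M_N(ℂ) ⊃ SU(N)` (the tree's `SUNBakryEmery.matD/Gam/Lap/genL/Gam2`); no measure, no number of record.  NOT weak
coupling, NOT a continuum statement, NOT a Yang–Mills mass-gap claim.

WHAT.  J-SC13 (`StrongCouplingSharpTwist`, pub-balaban) proved the twisted Bochner inequality on `SU(2)` with the twist `2/5` and the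
dimensional term `(tr T)²/3`, the latter by brute force on the 3-element core of the `𝔰𝔲(2)` frame.  Here, for every `N`:
* `gram_comm`, `sum_gram_smul_frame`, `sum_sum_gram_sq` — the Gram kernel `ι_{αβ} = ⟨Y_α, Y_β⟩ = −Re tr(Y_α Y_β)` of the tree's
  Parseval frame of `𝔰𝔲(N)` reconstructs every frame vector (`Y_α = ∑_β ι_{βα} Y_β`) and has `∑_{αβ} ι_{αβ}² = N² − 1 = dim 𝔰𝔲(N)`
  (Casimir `∑ Y_α² = −(N − 1/N)·1`);
* `sq_sum_diag_le` — the DIMENSIONAL BOUND `(∑_α τ(Y_α,Y_α))² ≤ (N² − 1) ∑_{αβ} ((τ(Y_α,Y_β) + τ(Y_β,Y_α))/2)²` for every kernel `τ`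
  that is frame-linear in each slot (expand `0 ≤ ∑_{αβ} (τ^{sym}_{αβ} − t ι_{αβ})²` and take the discriminant: `(tr T)² ≤ n‖T^{sym}‖²`
  without choosing a basis of `𝔰𝔲(N)`);
* `twisted_bochner` — for smooth `S, u` on `M_N(ℂ)`, every twist `θ ∈ ℝ` and every point `Q`:
  `(N/2)Γ(u,u) + (L_S u − (1−θ)Γ(S,u))²/(N²−1) + (θ²/2)(Γ(S,S)Γ(u,u) − Γ(S,u)²)
     ≤ Γ₂^S(u) + H + θ Γ(S,Γ(u,u)) + θ² Γ(S,S)Γ(u,u)`,  `H = ∑_{αβ} D_αu D_βu D_αD_βS`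
  (twisted tensor `T_{αβ} = D_αD_βu + θ D_αS D_βu`: `∑T² = ∑(D_αD_βu)² + θΓ(S,Γ(u,u)) + θ²Γ(S,S)Γ(u,u)`, Bochner `Γ₂ = ∑(D_αD_βu)² − H`,
  the Ricci identity `¼∑([D_α,D_β]u)² = (N/2)Γ(u,u)`, the vanishing cross terms `∑[D_α,D_β]u·D_αS D_βu = 0`, and `sq_sum_diag_le`).
  At `N = 2`, `θ = 2/5` this is J-SC13's `Gam_le_twisted` (with the slack `(1/25)(Γ(S,S)Γ − Γ(S,u)²)` kept).
USE.  `TwistedBochnerSU3` integrates it on `SU(3)` with `θ = 1/5`, where the isotropic third of the one-link Hessian cancels.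

References: D. Bakry, M. Émery, LNM 1123 (1985); Bakry–Gentil–Ledoux, Grundlehren 348 (2014) §1.16, C.6; the tree's
`SUNBakryEmeryFrame` / `SUNBakryEmeryPoincare` (Shen–Zhu–Zhu CMP 400 (2023) §4.1 frame calculus); cell note
`HOME/pub-ymgap-engine-2/TWISTED-BOCHNER-SU3.md`.
-/

noncomputable section

open scoped Matrix ComplexConjugate BigOperators Matrix.Norms.Frobenius ContDiff Topology
open Matrix Complex Finset MeasureTheory
open Literature.MathematicalPhysics.QuantumFieldTheory
open Literature.MathematicalPhysics.QuantumFieldTheory.SUNBakryEmery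
open Summit.QuantumFields.BalabanUV.InfraRed.StrongCouplingSharpTwist
  (sum_sum_comm_mul_eq_zero_left sum_sum_comm_mul_eq_zero_right Gam_Gam_self_eq)

namespace Summit.Ventures.YMGap.TwistedBochner

variable {N : ℕ}

/-! ### 1. The Gram kernel of the Parseval frame -/

/-- The Gram kernel `ι_{αβ} = ⟨Y_α, Y_β⟩ = −Re tr(Y_α Y_β)` of the tree's Parseval frame of `𝔰𝔲(N)` is symmetric. [folklore] -/
theorem gram_comm (α β : FrameIdx N) : -(frame (N := N) α * frame β).trace.re = -(frame β * frame α).trace.re := by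
  rw [trace_mul_comm]

/-- **Reconstruction**: `Y_α = ∑_β ι_{βα} Y_β` (the frame is Parseval on `𝔰𝔲(N) ∋ Y_α`). [folklore] -/
theorem sum_gram_smul_frame (hN : N ≠ 0) (α : FrameIdx N) :
    ∑ β, (-(frame β * frame α).trace.re) • frame β = frame (N := N) α :=
  sum_re_trace_smul_frame hN (frame_conjTranspose α) (frame_trace hN α)

/-- `∑_β ι_{αβ}² = ‖Y_α‖_F²` (Parseval). [folklore] -/
theorem sum_gram_sq (hN : N ≠ 0) (α : FrameIdx N) :
    ∑ β, (-(frame α * frame β).trace.re) ^ 2 = frobNorm (frame (N := N) α) ^ 2 := by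
  rw [← sum_sq_re_trace_frame_mul hN (frame_conjTranspose α) (frame_trace hN α)]
  refine sum_congr rfl fun β _ => ?_
  rw [trace_mul_comm, neg_sq]

/-- `∑_α ‖Y_α‖_F² = N² − 1 = dim 𝔰𝔲(N)` (from the Casimir identity `∑_α Y_α² = −(N − 1/N)·1`). [folklore] -/
theorem sum_frobNorm_frame_sq (hN : N ≠ 0) : ∑ α, frobNorm (frame (N := N) α) ^ 2 = (N : ℝ) ^ 2 - 1 := by
  have hN' : (N : ℂ) ≠ 0 := Nat.cast_ne_zero.2 hN
  have h1 : ∀ α : FrameIdx N, frobNorm (frame α) ^ 2 = -(frame α * frame α).trace.re :=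
    fun α => frobNorm_sq_of_skew (frame_conjTranspose α)
  simp_rw [h1]
  rw [sum_neg_distrib, ← Complex.re_sum, ← trace_sum, sum_frame_mul_frame hN]
  simp only [trace_neg, trace_smul, trace_one, Fintype.card_fin, smul_eq_mul, Complex.neg_re, neg_neg]
  have e : ((N : ℂ) - 1 / N) * N = (((N : ℝ) ^ 2 - 1 : ℝ) : ℂ) := by
    field_simp
    push_cast
    ring
  rw [e, Complex.ofReal_re]

/-- `∑_{αβ} ι_{αβ}² = N² − 1`. [folklore] -/
theorem sum_sum_gram_sq (hN : N ≠ 0) : ∑ α, ∑ β, (-(frame (N := N) α * frame β).trace.re) ^ 2 = (N : ℝ) ^ 2 - 1 := by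
  simp_rw [sum_gram_sq hN]
  exact sum_frobNorm_frame_sq hN

/-! ### 2. The dimensional bound through the Gram identity -/

/-- **Dimensional bound** `(tr T)² ≤ dim 𝔰𝔲(N) · ‖T^{sym}‖²` in the frame: for a kernel `τ` on `M_N(ℂ) × M_N(ℂ)` that is
frame-linear in each slot, `(∑_α τ(Y_α,Y_α))² ≤ (N² − 1) ∑_{αβ} ((τ(Y_α,Y_β) + τ(Y_β,Y_α))/2)²`.  Proof: with
`S_{αβ} = (τ_{αβ} + τ_{βα})/2`, reconstruction gives `∑_β ι_{αβ} S_{αβ} = τ_{αα}`, so `0 ≤ ∑(S − tι)² = ∑S² − 2t·tr + t²(N²−1)` for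
every `t`, and the discriminant is `≤ 0`. [folklore] -/
theorem sq_sum_diag_le (hN : N ≠ 0) (τ : Matrix (Fin N) (Fin N) ℂ → Matrix (Fin N) (Fin N) ℂ → ℝ)
    (h1 : ∀ (X : Matrix (Fin N) (Fin N) ℂ) (c : FrameIdx N → ℝ), τ X (∑ β, c β • frame β) = ∑ β, c β * τ X (frame β))
    (h2 : ∀ (Y : Matrix (Fin N) (Fin N) ℂ) (c : FrameIdx N → ℝ), τ (∑ β, c β • frame β) Y = ∑ β, c β * τ (frame β) Y) :
    (∑ α, τ (frame α) (frame α)) ^ 2 ≤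
      ((N : ℝ) ^ 2 - 1) * ∑ α, ∑ β, ((τ (frame α) (frame β) + τ (frame β) (frame α)) / 2) ^ 2 := by
  -- `∑_β ι_{αβ} S_{αβ} = τ_{αα}`
  have hrec : ∀ α : FrameIdx N, ∑ β, (-(frame α * frame β).trace.re) * ((τ (frame α) (frame β) + τ (frame β) (frame α)) / 2) =
      τ (frame α) (frame α) := by
    intro α
    have e1 : ∑ β, (-(frame β * frame α).trace.re) * τ (frame α) (frame β) = τ (frame α) (frame α) := by
      rw [← h1 (frame α) (fun β => -(frame β * frame α).trace.re), sum_gram_smul_frame hN α]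
    have e2 : ∑ β, (-(frame β * frame α).trace.re) * τ (frame β) (frame α) = τ (frame α) (frame α) := by
      rw [← h2 (frame α) (fun β => -(frame β * frame α).trace.re), sum_gram_smul_frame hN α]
    calc ∑ β, (-(frame α * frame β).trace.re) * ((τ (frame α) (frame β) + τ (frame β) (frame α)) / 2)
        = ((∑ β, (-(frame β * frame α).trace.re) * τ (frame α) (frame β)) +
            ∑ β, (-(frame β * frame α).trace.re) * τ (frame β) (frame α)) / 2 := by
          rw [← sum_add_distrib, Finset.sum_div]
          refine sum_congr rfl fun β _ => ?_
          rw [gram_comm α β]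
          ring
      _ = τ (frame α) (frame α) := by rw [e1, e2]; ring
  -- the nonnegative quadratic in `t`
  have hq : ∀ t : ℝ, 0 ≤ ((N : ℝ) ^ 2 - 1) * (t * t) + (-2 * ∑ α, τ (frame α) (frame α)) * t +
      ∑ α, ∑ β, ((τ (frame α) (frame β) + τ (frame β) (frame α)) / 2) ^ 2 := by
    intro t
    have h0 : 0 ≤ ∑ α, ∑ β, (((τ (frame α) (frame β) + τ (frame β) (frame α)) / 2) - t * (-(frame α * frame β).trace.re)) ^ 2 :=
      sum_nonneg fun α _ => sum_nonneg fun β _ => sq_nonneg _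
    have hexp : ∑ α, ∑ β, (((τ (frame α) (frame β) + τ (frame β) (frame α)) / 2) - t * (-(frame α * frame β).trace.re)) ^ 2 =
        ∑ α, ∑ β, ((τ (frame α) (frame β) + τ (frame β) (frame α)) / 2) ^ 2
          - 2 * t * ∑ α, ∑ β, (-(frame α * frame β).trace.re) * ((τ (frame α) (frame β) + τ (frame β) (frame α)) / 2)
          + t ^ 2 * ∑ α, ∑ β, (-(frame (N := N) α * frame β).trace.re) ^ 2 := by
      simp only [mul_sum, ← sum_sub_distrib, ← sum_add_distrib]
      refine sum_congr rfl fun α _ => sum_congr rfl fun β _ => ?_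
      ring
    rw [hexp, sum_sum_gram_sq hN] at h0
    simp_rw [hrec] at h0
    linarith [h0]
  have hd := discrim_le_zero hq
  rw [discrim] at hd
  nlinarith [hd]

/-! ### 3. The twisted pointwise Bochner inequality on `SU(N)` -/

section Calculus

/-- **The pointwise twisted Bochner inequality on `SU(N)`, every `N ≥ 1`, every twist `θ`** (twisted tensor
`T_{αβ} = D_αD_βu + θ D_αS D_βu`): for smooth `S, u` on `M_N(ℂ)` and every `Q`,
`(N/2)Γ(u,u) + (L_S u − (1−θ)Γ(S,u))²/(N²−1) + (θ²/2)(Γ(S,S)Γ(u,u) − Γ(S,u)²) ≤ Γ₂^S(u) + H + θΓ(S,Γ(u,u)) + θ²Γ(S,S)Γ(u,u)`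
with `H = ∑_{αβ} D_αu D_βu D_αD_βS` (for `N = 1` the dimensional term reads `0` by `1/0 = 0`).  Ingredients: Bochner's formula in the
frame (`Γ₂ = ∑(D_αD_βu)² − H`), `∑T² = ∑(D_αD_βu)² + θΓ(S,Γ(u,u)) + θ²Γ(S,S)Γ(u,u)`, the symmetric/antisymmetric split of `T`, the
dimensional bound `sq_sum_diag_le` for the symmetric part (`tr T = L_S u − (1−θ)Γ(S,u)`), the Ricci identity `∑([D_α,D_β]u)² = 2NΓ(u,u)`,
the vanishing cross terms, and `∑_{αβ}(D_αS D_βu − D_βS D_αu)² = 2(Γ(S,S)Γ(u,u) − Γ(S,u)²)`. [folklore] -/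
theorem twisted_bochner (hN : N ≠ 0) {S u : Matrix (Fin N) (Fin N) ℂ → ℝ} (hS : ContDiff ℝ ∞ S) (hu : ContDiff ℝ ∞ u)
    (θ : ℝ) (Q : Matrix (Fin N) (Fin N) ℂ) :
    (N : ℝ) / 2 * Gam u u Q + (1 / ((N : ℝ) ^ 2 - 1)) * (genL S u Q - (1 - θ) * Gam S u Q) ^ 2 +
        θ ^ 2 / 2 * (Gam S S Q * Gam u u Q - Gam S u Q ^ 2) ≤
      Gam2 S u Q + ∑ α, ∑ β, matD (frame α) u Q * matD (frame β) u Q * matD (frame α) (matD (frame β) S) Q +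
        θ * Gam S (Gam u u) Q + θ ^ 2 * (Gam S S Q * Gam u u Q) := by
  -- frame-linearity of the twisted kernel
  set τ : Matrix (Fin N) (Fin N) ℂ → Matrix (Fin N) (Fin N) ℂ → ℝ :=
    fun X Y => matD X (matD Y u) Q + θ * matD X S Q * matD Y u Q with hτ
  have hlin : ∀ c : FrameIdx N → ℝ, matD (∑ β, c β • frame β) u = fun Q' => ∑ β, c β * matD (frame β) u Q' := by
    intro c
    funext Q'
    exact matD_sum_smul_dir univ c frame u Q'
  have h1 : ∀ (X : Matrix (Fin N) (Fin N) ℂ) (c : FrameIdx N → ℝ),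
      τ X (∑ β, c β • frame β) = ∑ β, c β * τ X (frame β) := by
    intro X c
    have e : ∀ β : FrameIdx N, matD X (fun Q' => c β * matD (frame β) u Q') Q = c β * matD X (matD (frame β) u) Q :=
      fun β => congrFun (matD_const_mul (contDiff_matD hu (frame β)) (c β) X) Q
    show matD X (matD (∑ β, c β • frame β) u) Q + θ * matD X S Q * matD (∑ β, c β • frame β) u Q =
      ∑ β, c β * (matD X (matD (frame β) u) Q + θ * matD X S Q * matD (frame β) u Q)
    rw [hlin c, matD_sum univ (F := fun β Q' => c β * matD (frame β) u Q')
      (fun β _ => contDiff_const.mul (contDiff_matD hu _))]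
    beta_reduce
    simp only [e, mul_sum, ← sum_add_distrib]
    exact sum_congr rfl fun β _ => by ring
  have h2 : ∀ (Y : Matrix (Fin N) (Fin N) ℂ) (c : FrameIdx N → ℝ),
      τ (∑ β, c β • frame β) Y = ∑ β, c β * τ (frame β) Y := by
    intro Y c
    show matD (∑ β, c β • frame β) (matD Y u) Q + θ * matD (∑ β, c β • frame β) S Q * matD Y u Q =
      ∑ β, c β * (matD (frame β) (matD Y u) Q + θ * matD (frame β) S Q * matD Y u Q)
    rw [matD_sum_smul_dir, matD_sum_smul_dir, mul_sum, sum_mul, ← sum_add_distrib]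
    exact sum_congr rfl fun β _ => by ring
  have hdimG := sq_sum_diag_le hN τ h1 h2
  simp only [hτ] at hdimG
  -- the diagonal `tr T = Δu + θΓ(S,u) = L_S u − (1−θ)Γ(S,u)`
  have hdiag : ∑ α, (matD (frame α) (matD (frame α) u) Q + θ * matD (frame α) S Q * matD (frame α) u Q) =
      genL S u Q - (1 - θ) * Gam S u Q := by
    have e1 : ∑ α, (matD (frame α) (matD (frame α) u) Q + θ * matD (frame α) S Q * matD (frame α) u Q) =
        ∑ α, matD (frame α) (matD (frame α) u) Q + θ * ∑ α, matD (frame α) S Q * matD (frame α) u Q := by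
      rw [sum_add_distrib, mul_sum]
      refine congrArg₂ (· + ·) rfl (sum_congr rfl fun α _ => by ring)
    rw [e1]
    simp only [genL, Lap, Gam]
    ring
  rw [hdiag] at hdimG
  -- the expansion of `∑ T²`
  have hX1 := Gam_Gam_self_eq (S := S) hu Q
  have hprod : Gam S S Q * Gam u u Q = ∑ α, ∑ β, matD (frame α) S Q ^ 2 * matD (frame β) u Q ^ 2 := by
    rw [Gam_self_eq_sum_sq, Gam_self_eq_sum_sq, sum_mul_sum]
  have hG2 : Gam S u Q ^ 2 = ∑ α, ∑ β, (matD (frame α) S Q * matD (frame α) u Q) * (matD (frame β) S Q * matD (frame β) u Q) := by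
    rw [sq, Gam, sum_mul_sum]
  have hexp : ∑ α, ∑ β, (matD (frame α) (matD (frame β) u) Q + θ * matD (frame α) S Q * matD (frame β) u Q) ^ 2 =
      ∑ α, ∑ β, matD (frame α) (matD (frame β) u) Q ^ 2 + θ * Gam S (Gam u u) Q +
        θ ^ 2 * (Gam S S Q * Gam u u Q) := by
    rw [hX1, hprod]
    calc ∑ α, ∑ β, (matD (frame α) (matD (frame β) u) Q + θ * matD (frame α) S Q * matD (frame β) u Q) ^ 2
        = ∑ α, ∑ β, (matD (frame α) (matD (frame β) u) Q ^ 2 +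
            2 * θ * (matD (frame α) S Q * matD (frame β) u Q * matD (frame α) (matD (frame β) u) Q) +
            θ ^ 2 * (matD (frame α) S Q ^ 2 * matD (frame β) u Q ^ 2)) :=
          sum_congr rfl fun α _ => sum_congr rfl fun β _ => by ring
      _ = ∑ α, ∑ β, matD (frame α) (matD (frame β) u) Q ^ 2 +
            2 * θ * ∑ α, ∑ β, matD (frame α) S Q * matD (frame β) u Q * matD (frame α) (matD (frame β) u) Q +
            θ ^ 2 * ∑ α, ∑ β, matD (frame α) S Q ^ 2 * matD (frame β) u Q ^ 2 := by
          simp only [sum_add_distrib, mul_sum]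
      _ = _ := by ring
  -- symmetric / antisymmetric split of `∑ T²`
  have hsplit : ∑ α, ∑ β, (matD (frame α) (matD (frame β) u) Q + θ * matD (frame α) S Q * matD (frame β) u Q) ^ 2 =
      ∑ α, ∑ β, (((matD (frame α) (matD (frame β) u) Q + θ * matD (frame α) S Q * matD (frame β) u Q) +
          (matD (frame β) (matD (frame α) u) Q + θ * matD (frame β) S Q * matD (frame α) u Q)) / 2) ^ 2 +
        (1 / 4) * ∑ α, ∑ β, ((matD (frame α) (matD (frame β) u) Q + θ * matD (frame α) S Q * matD (frame β) u Q) -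
          (matD (frame β) (matD (frame α) u) Q + θ * matD (frame β) S Q * matD (frame α) u Q)) ^ 2 := by
    have h : ∑ α, ∑ β, (((matD (frame α) (matD (frame β) u) Q + θ * matD (frame α) S Q * matD (frame β) u Q) +
          (matD (frame β) (matD (frame α) u) Q + θ * matD (frame β) S Q * matD (frame α) u Q)) / 2) ^ 2 +
        (1 / 4) * ∑ α, ∑ β, ((matD (frame α) (matD (frame β) u) Q + θ * matD (frame α) S Q * matD (frame β) u Q) -
          (matD (frame β) (matD (frame α) u) Q + θ * matD (frame β) S Q * matD (frame α) u Q)) ^ 2 =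
        (1 / 2) * ∑ α, ∑ β, (matD (frame α) (matD (frame β) u) Q + θ * matD (frame α) S Q * matD (frame β) u Q) ^ 2 +
          (1 / 2) * ∑ α, ∑ β, (matD (frame β) (matD (frame α) u) Q + θ * matD (frame β) S Q * matD (frame α) u Q) ^ 2 := by
      rw [mul_sum, mul_sum, mul_sum, ← sum_add_distrib, ← sum_add_distrib]
      refine sum_congr rfl fun α _ => ?_
      rw [mul_sum, mul_sum, mul_sum, ← sum_add_distrib, ← sum_add_distrib]
      refine sum_congr rfl fun β _ => ?_
      ring
    rw [h, sum_comm (f := fun α β => (matD (frame β) (matD (frame α) u) Q + θ * matD (frame β) S Q * matD (frame α) u Q) ^ 2)]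
    ring
  -- the antisymmetric part: Ricci identity, vanishing cross terms, Lagrange identity
  have hR := sum_sum_sq_comm_matD hN hu Q
  have hc1 := sum_sum_comm_mul_eq_zero_left hN hu (fun α => matD (frame α) S Q) Q
  have hc2 := sum_sum_comm_mul_eq_zero_right hN hu (fun β => matD (frame β) S Q) Q
  have hLag : ∑ α, ∑ β, (matD (frame α) S Q * matD (frame β) u Q - matD (frame β) S Q * matD (frame α) u Q) ^ 2 =
      2 * (Gam S S Q * Gam u u Q - Gam S u Q ^ 2) := by
    rw [hprod, hG2]
    have e : ∑ α, ∑ β, (matD (frame α) S Q * matD (frame β) u Q - matD (frame β) S Q * matD (frame α) u Q) ^ 2 =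
        ∑ α, ∑ β, matD (frame α) S Q ^ 2 * matD (frame β) u Q ^ 2 +
          ∑ α, ∑ β, matD (frame β) S Q ^ 2 * matD (frame α) u Q ^ 2 -
          2 * ∑ α, ∑ β, (matD (frame α) S Q * matD (frame α) u Q) * (matD (frame β) S Q * matD (frame β) u Q) := by
      simp only [mul_sum, ← sum_add_distrib, ← sum_sub_distrib]
      refine sum_congr rfl fun α _ => sum_congr rfl fun β _ => ?_
      ring
    rw [e, sum_comm (f := fun α β => matD (frame β) S Q ^ 2 * matD (frame α) u Q ^ 2)]
    ring
  have hanti : ∑ α, ∑ β, ((matD (frame α) (matD (frame β) u) Q + θ * matD (frame α) S Q * matD (frame β) u Q) -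
        (matD (frame β) (matD (frame α) u) Q + θ * matD (frame β) S Q * matD (frame α) u Q)) ^ 2 =
      2 * N * Gam u u Q + 2 * θ ^ 2 * (Gam S S Q * Gam u u Q - Gam S u Q ^ 2) := by
    have e : ∑ α, ∑ β, ((matD (frame α) (matD (frame β) u) Q + θ * matD (frame α) S Q * matD (frame β) u Q) -
          (matD (frame β) (matD (frame α) u) Q + θ * matD (frame β) S Q * matD (frame α) u Q)) ^ 2 =
        ∑ α, ∑ β, (matD (frame α) (matD (frame β) u) Q - matD (frame β) (matD (frame α) u) Q) ^ 2 +
          2 * θ * ∑ α, ∑ β, (matD (frame α) (matD (frame β) u) Q - matD (frame β) (matD (frame α) u) Q) *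
            (matD (frame α) S Q * matD (frame β) u Q) -
          2 * θ * ∑ α, ∑ β, (matD (frame α) (matD (frame β) u) Q - matD (frame β) (matD (frame α) u) Q) *
            (matD (frame β) S Q * matD (frame α) u Q) +
          θ ^ 2 * ∑ α, ∑ β, (matD (frame α) S Q * matD (frame β) u Q - matD (frame β) S Q * matD (frame α) u Q) ^ 2 := by
      simp only [mul_sum, ← sum_add_distrib, ← sum_sub_distrib]
      refine sum_congr rfl fun α _ => sum_congr rfl fun β _ => ?_
      ring
    rw [e, hR, hc1, hc2, hLag]
    ring
  -- Bochner's formula in the frame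
  have hBoch := Gam2_eq hN hS hu Q
  -- the dimensional term (for `N = 1` it vanishes by `1/0 = 0`)
  have hSnonneg : 0 ≤ ∑ α, ∑ β, (((matD (frame α) (matD (frame β) u) Q + θ * matD (frame α) S Q * matD (frame β) u Q) +
      (matD (frame β) (matD (frame α) u) Q + θ * matD (frame β) S Q * matD (frame α) u Q)) / 2) ^ 2 :=
    sum_nonneg fun α _ => sum_nonneg fun β _ => sq_nonneg _
  have hdim : (1 / ((N : ℝ) ^ 2 - 1)) * (genL S u Q - (1 - θ) * Gam S u Q) ^ 2 ≤
      ∑ α, ∑ β, (((matD (frame α) (matD (frame β) u) Q + θ * matD (frame α) S Q * matD (frame β) u Q) +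
        (matD (frame β) (matD (frame α) u) Q + θ * matD (frame β) S Q * matD (frame α) u Q)) / 2) ^ 2 := by
    rcases eq_or_ne ((N : ℝ) ^ 2 - 1) 0 with h0 | h0
    · rw [h0, div_zero, zero_mul]
      exact hSnonneg
    · have hN1 : (1 : ℝ) ≤ N := by exact_mod_cast Nat.one_le_iff_ne_zero.2 hN
      have hpos : 0 < (N : ℝ) ^ 2 - 1 := lt_of_le_of_ne (by nlinarith) (Ne.symm h0)
      rw [one_div, inv_mul_le_iff₀ hpos]
      exact hdimG
  nlinarith [hdim, hexp, hsplit, hanti, hBoch, hSnonneg]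

end Calculus

end Summit.Ventures.YMGap.TwistedBochner

end
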